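import Summits.AtomisticToContinuum.FouriersLaw.Theorems.OddSectorIrreversibilityTapLeakBoundMixedTap

/-!
# `TapLeakBound` (stmt-AtomisticToContinuum-15159), line `SketchIdeator2`, stub `stub_mixedTap`: the local moment of `∂_{q_b} J`

Helper file (`--supports stmt-AtomisticToContinuum-15159`) for crux P =
`Summit.AtomisticToContinuum.FouriersLaw.Theses.OddSectorIrreversibility.TapLeakBound` (route
`OddSectorIrreversibility`, sub-problem `FouriersLaw`). It discharges hypothesis (Q) of the landed reduction
`stub_mixedTapReduction` (…TapLeakBoundMixedTap.lean) of the registered stub `stub_mixedTap` (= `MixedTapBound`),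
leaving exactly its two honest residuals (M) `∂_{q_b}u ∈ L²(μ_T)` (fixed `N`) and (D) the `N`-uniform Hessian-drive
budget (R1 + R2 of card drain-convexity-second-tap-identity): `mixedTapBound_of_membership_of_hessianDrive`.

**The `N`-uniform bound `‖∂_{q_b} J‖²_{L²(μ_T)} ≤ C · Z`** (`μ_T = gibbsWeight`, unnormalised; `Z = ∫e^{-H/T}`;
`J = Σ_k j_k`, `j_k = −½(p_k + p_{k+1})V'(q_{k+1} − q_k)`, `V'' = 1 + 3βr²`, `pinnedChain_deriv_deriv_V`).
The position derivative of the total current is LOCAL: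
`∂_{q_b} J = A_{b-1,b}[0 < b] − A_{b,b+1}[b+1 < N]`, `A_{kj} = −(p_k + p_j)/2 · V''(q_j − q_k)`
(`partialQ_sum_bondCurrent`: differentiate the double bond sum along the `q_b`-line,
`hasDerivAt_sum_bondCurrent_positionLine`, and collapse `Σ_kΣ_j[j=k+1]A_{kj}(δ_{jb} − δ_{kb})`,
`sum_sum_ite_succ_mul_delta_sub`, `sum_ite_eq_pred`, `sum_ite_eq_succ`). Pointwise
`A_{ij}² ≤ W(i,j) = p_i² + p_j² + 72β²(p_i⁴ + p_j⁴ + q_i⁸ + q_j⁸)` (`sq_bondPair_le`), so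
`(∂_{q_b}J)² ≤ 2W(j₁,b) + 2W(b,j₂)` for two sites `j₁, j₂`, and the landed `N`-UNIFORM single-coordinate Gibbs
moments `∫p_k² ≤ C₁Z`, `∫p_k⁴ ≤ C₂Z`, `∫q_k⁸ ≤ C₄Z` (`SubBallisticWindow.GibbsMoments.stub_gibbsMoments` with
`…GibbsPoincare.stub_gibbsPoincare`) give `∫(∂_{q_b}J)² dμ_T ≤ 4(2C₁ + 144β²(C₂ + C₄)) Z` at every site `b` and
every `N` (`localMomentQ_core`, `stub_localMomentQ`); membership in `L²(μ_T)` by continuity + integrable square.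
Same pattern as the landed `stub_localMoment` (`∂_{p_b} J`). References: folklore. Nothing here closes the item.
-/

noncomputable section

open MeasureTheory ProbabilityTheory Filter Topology Set Function
open scoped NNReal ENNReal ContDiff

namespace Summit.AtomisticToContinuum.FouriersLaw.Theorems.OddSectorIrreversibility.TapLeak

open Literature.MathematicalPhysics.KineticTheory.HeatConduction
open Literature.MathematicalPhysics.KineticTheory
open Summit.AtomisticToContinuum.FouriersLaw.Theorems.OddSectorWitness
open Summit.AtomisticToContinuum.FouriersLaw.Theorems.OddSectorIrreversibility.Corrector
open Summit.AtomisticToContinuum.FouriersLaw.Theorems.SubBallisticWindow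

variable {N : ℕ}

/-! ### The position derivative of the total current -/

/-- **`∂_{q_b}` of the total current, double-sum form.** Along the `q_b`-line the total current
`J = Σ_k Σ_j [j = k+1] (−(p_k + p_j)/2 · V'(q_j − q_k))` has derivative
`Σ_k Σ_j [j = k+1] (−(p_k + p_j)/2 · V''(q_j − q_k)) (δ_{jb} − δ_{kb})` (`V'` differentiable). [folklore] -/
theorem hasDerivAt_sum_bondCurrent_positionLine (P : OscillatorChain) (hV : Differentiable ℝ (deriv P.V))
    (b : Fin N) (x : PhaseSpace N) :
    HasDerivAt (fun t => ∑ k : Fin N, P.bondCurrent N k (Function.update x.1 b t, x.2))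
      (∑ k : Fin N, ∑ j : Fin N, if j.val = k.val + 1 then
        -((x.2 k + x.2 j) / 2 * deriv (deriv P.V) (x.1 j - x.1 k)) *
          ((if j = b then (1 : ℝ) else 0) - (if k = b then (1 : ℝ) else 0)) else 0) (x.1 b) := by
  unfold OscillatorChain.bondCurrent
  refine HasDerivAt.fun_sum fun k _ => HasDerivAt.fun_sum fun j _ => ?_
  by_cases h : j.val = k.val + 1
  · simp only [h, if_true]
    have hd : HasDerivAt (fun t => Function.update x.1 b t j - Function.update x.1 b t k)
        ((if j = b then (1 : ℝ) else 0) - (if k = b then (1 : ℝ) else 0)) (x.1 b) :=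
      (hasDerivAt_update_coord x.1 b j (x.1 b)).sub (hasDerivAt_update_coord x.1 b k (x.1 b))
    have hc := (((hV _).hasDerivAt.comp (x.1 b) hd).const_mul ((x.2 k + x.2 j) / 2)).neg
    refine hc.congr_deriv ?_
    simp only [Function.update_eq_self]
    ring
  · simp only [h, if_false]
    exact hasDerivAt_const _ _

/-- Collapse of the bond double sum against `δ_{jb} − δ_{kb}`:
`Σ_k Σ_j [j = k+1] A_{kj} (δ_{jb} − δ_{kb}) = Σ_k [b = k+1] A_{kb} − Σ_j [j = b+1] A_{bj}`. [folklore] -/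
theorem sum_sum_ite_succ_mul_delta_sub (A : Fin N → Fin N → ℝ) (b : Fin N) :
    (∑ k : Fin N, ∑ j : Fin N, if j.val = k.val + 1 then
        A k j * ((if j = b then (1 : ℝ) else 0) - (if k = b then (1 : ℝ) else 0)) else 0) =
      (∑ k : Fin N, if b.val = k.val + 1 then A k b else 0) -
        ∑ j : Fin N, if j.val = b.val + 1 then A b j else 0 := by
  have e1 : ∀ k j : Fin N, (if j.val = k.val + 1 then
      A k j * ((if j = b then (1 : ℝ) else 0) - (if k = b then (1 : ℝ) else 0)) else 0) =
      (if j = b then (if j.val = k.val + 1 then A k j else 0) else 0) -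
        (if k = b then (if j.val = k.val + 1 then A k j else 0) else 0) := by
    intro k j
    split_ifs <;> ring
  simp_rw [e1, Finset.sum_sub_distrib]
  congr 1
  · refine Finset.sum_congr rfl fun k _ => ?_
    rw [Finset.sum_ite_eq' Finset.univ b, if_pos (Finset.mem_univ b)]
  · rw [Finset.sum_comm]
    refine Finset.sum_congr rfl fun j _ => ?_
    rw [Finset.sum_ite_eq' Finset.univ b, if_pos (Finset.mem_univ b)]

/-- `Σ_k [b = k+1] F_k = F_{b-1}` if `0 < b`, else `0`. [folklore] -/
theorem sum_ite_eq_pred (F : Fin N → ℝ) (b : Fin N) :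
    (∑ k : Fin N, if b.val = k.val + 1 then F k else 0) = if h : 0 < b.val then F ⟨b.val - 1, by omega⟩ else 0 := by
  -- adapted from `sum_ite_eq_leftTerm` (Literature/Barriers/AtomisticToContinuum/SpectralGapClosing)
  split_ifs with h
  · rw [Finset.sum_eq_single ⟨b.val - 1, by omega⟩]
    · simp only
      rw [if_pos (by omega)]
    · intro k _ hk
      rw [if_neg]
      intro h'
      apply hk
      ext
      simp only
      omega
    · intro h'
      exact absurd (Finset.mem_univ _) h'
  · exact Finset.sum_eq_zero fun k _ => by rw [if_neg (by omega)]

/-- `Σ_j [j = b+1] F_j = F_{b+1}` if `b + 1 < N`, else `0`. [folklore] -/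
theorem sum_ite_eq_succ (F : Fin N → ℝ) (b : Fin N) :
    (∑ j : Fin N, if j.val = b.val + 1 then F j else 0) = if h : b.val + 1 < N then F ⟨b.val + 1, h⟩ else 0 := by
  -- adapted from `sum_ite_eq_rightTerm` (Literature/Barriers/AtomisticToContinuum/SpectralGapClosing)
  split_ifs with h
  · rw [Finset.sum_eq_single ⟨b.val + 1, h⟩]
    · simp
    · intro j _ hj
      rw [if_neg]
      intro h'
      apply hj
      ext
      simp only
      omega
    · intro h'
      exact absurd (Finset.mem_univ _) h'
  · refine Finset.sum_eq_zero fun j _ => ?_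
    rw [if_neg]
    intro h'
    exact h (h' ▸ j.isLt)

/-- **`∂_{q_b} J` is local**: with `A_{kj} = −(p_k + p_j)/2 · V''(q_j − q_k)`,
`∂_{q_b} J = A_{b-1,b}·[0 < b] − A_{b,b+1}·[b+1 < N]` (the two bonds touching `b`). [folklore] -/
theorem partialQ_sum_bondCurrent (P : OscillatorChain) (hV : Differentiable ℝ (deriv P.V)) (b : Fin N)
    (x : PhaseSpace N) :
    partialQ b (fun y : PhaseSpace N => ∑ k : Fin N, P.bondCurrent N k y) x =
      (if h : 0 < b.val then
        -((x.2 ⟨b.val - 1, by omega⟩ + x.2 b) / 2 * deriv (deriv P.V) (x.1 b - x.1 ⟨b.val - 1, by omega⟩))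
        else 0) -
      (if h : b.val + 1 < N then
        -((x.2 b + x.2 ⟨b.val + 1, h⟩) / 2 * deriv (deriv P.V) (x.1 ⟨b.val + 1, h⟩ - x.1 b)) else 0) := by
  have h := (hasDerivAt_sum_bondCurrent_positionLine P hV b x).deriv
  unfold partialQ
  rw [h, sum_sum_ite_succ_mul_delta_sub (fun k j => -((x.2 k + x.2 j) / 2 * deriv (deriv P.V) (x.1 j - x.1 k))) b,
    sum_ite_eq_pred, sum_ite_eq_succ]

/-! ### Pointwise majorant -/

/-- The elementary bound behind the local moment: for `V'' = 1 + 3βr²`,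
`((p + p')/2 · V''(q' − q))² ≤ p² + p'² + 72β²(p⁴ + p'⁴ + q⁸ + q'⁸)`. [folklore] -/
theorem sq_bondPair_le (β p p' q q' : ℝ) :
    ((p + p') / 2 * (1 + 3 * β * (q' - q) ^ 2)) ^ 2 ≤
      p ^ 2 + p' ^ 2 + 72 * β ^ 2 * (p ^ 4 + p' ^ 4 + q ^ 8 + q' ^ 8) := by
  set r := q' - q with hr
  have h1 : ((p + p') / 2) ^ 2 ≤ (p ^ 2 + p' ^ 2) / 2 := by nlinarith [sq_nonneg (p - p')]
  have h2 : (1 + 3 * β * r ^ 2) ^ 2 ≤ 2 + 18 * β ^ 2 * r ^ 4 := by nlinarith [sq_nonneg (1 - 3 * β * r ^ 2)]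
  have h3 : r ^ 2 ≤ 2 * (q ^ 2 + q' ^ 2) := by nlinarith [sq_nonneg (q + q')]
  have h4 : r ^ 4 ≤ 8 * (q ^ 4 + q' ^ 4) := by
    have h31 : r ^ 4 ≤ (2 * (q ^ 2 + q' ^ 2)) ^ 2 := by
      rw [show r ^ 4 = (r ^ 2) ^ 2 by ring]
      exact pow_le_pow_left₀ (sq_nonneg r) h3 2
    nlinarith [sq_nonneg (q ^ 2 - q' ^ 2)]
  have h5 : (1 + 3 * β * r ^ 2) ^ 2 ≤ 2 + 144 * β ^ 2 * (q ^ 4 + q' ^ 4) := by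
    have := mul_le_mul_of_nonneg_left h4 (show 0 ≤ 18 * β ^ 2 by positivity)
    linarith
  have hA : 0 ≤ ((p + p') / 2) ^ 2 := sq_nonneg _
  have hB : 0 ≤ (1 + 3 * β * r ^ 2) ^ 2 := sq_nonneg _
  have h6 : ((p + p') / 2 * (1 + 3 * β * r ^ 2)) ^ 2 ≤
      (p ^ 2 + p' ^ 2) / 2 * (2 + 144 * β ^ 2 * (q ^ 4 + q' ^ 4)) := by
    rw [mul_pow]
    exact mul_le_mul h1 h5 hB (by positivity)
  -- `p² q⁴ ≤ (p⁴ + q⁸)/2`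
  have h7 : (p ^ 2 + p' ^ 2) * (q ^ 4 + q' ^ 4) ≤ p ^ 4 + p' ^ 4 + q ^ 8 + q' ^ 8 := by
    nlinarith [sq_nonneg (p ^ 2 - q ^ 4), sq_nonneg (p ^ 2 - q' ^ 4), sq_nonneg (p' ^ 2 - q ^ 4),
      sq_nonneg (p' ^ 2 - q' ^ 4)]
  have h8 : (p ^ 2 + p' ^ 2) / 2 * (2 + 144 * β ^ 2 * (q ^ 4 + q' ^ 4)) =
      p ^ 2 + p' ^ 2 + 72 * β ^ 2 * ((p ^ 2 + p' ^ 2) * (q ^ 4 + q' ^ 4)) := by ring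
  have h9 := mul_le_mul_of_nonneg_left h7 (show 0 ≤ 72 * β ^ 2 by positivity)
  linarith

/-! ### The Gibbs integral of the majorant and the core estimate at fixed `N` -/

section Core

variable {ω₂ lam β : ℝ} (hω : 0 < ω₂) (hl : 0 ≤ lam) (hβ : 0 ≤ β) (γ : ℝ) {T : ℝ} (hT : 0 < T)
include hω hl hβ hT

/-- Every monomial `p_i^k` is integrable against the Gibbs weight. [folklore] -/
theorem localMomentQ_integrable_momentum_pow (i : Fin N) (k : ℕ) :
    Integrable (fun x : PhaseSpace N => (x.2 i) ^ k) (gibbsWeight ω₂ lam β γ N T) :=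
  GibbsMoments.integrable_pow_gibbs γ N hω hl hβ hT rfl ((continuous_apply i).comp continuous_snd)
    (GibbsMoments.abs_momentum_le hω.le hl hβ γ N · i) k

/-- The majorant `W(i,j) = p_i² + p_j² + 72β²(p_i⁴ + p_j⁴ + q_i⁸ + q_j⁸)` is `μ_T`-integrable with
`∫ W(i,j) dμ_T ≤ (2C₁ + 144β²(C₂ + C₄)) Z` whenever `∫ p_k² dμ_T ≤ C₁ Z`, `∫ p_k⁴ dμ_T ≤ C₂ Z` and
`∫ q_k⁸ dμ_T ≤ C₄ Z` for all sites `k`. [folklore] -/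
theorem localMomentQ_integral_majorant_le {C₁ C₂ C₄ : ℝ}
    (hp2 : ∀ k : Fin N, ∫ x, (x.2 k) ^ 2 ∂(gibbsWeight ω₂ lam β γ N T) ≤
      C₁ * ∫ x, Real.exp (-((pinnedChain ω₂ lam β γ).hamiltonian N x) / T) ∂volume)
    (hp4 : ∀ k : Fin N, ∫ x, (x.2 k) ^ 4 ∂(gibbsWeight ω₂ lam β γ N T) ≤
      C₂ * ∫ x, Real.exp (-((pinnedChain ω₂ lam β γ).hamiltonian N x) / T) ∂volume)
    (hq8 : ∀ k : Fin N, ∫ x, (x.1 k) ^ 8 ∂(gibbsWeight ω₂ lam β γ N T) ≤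
      C₄ * ∫ x, Real.exp (-((pinnedChain ω₂ lam β γ).hamiltonian N x) / T) ∂volume)
    (i j : Fin N) :
    Integrable (fun x : PhaseSpace N => (x.2 i) ^ 2 + (x.2 j) ^ 2 +
        72 * β ^ 2 * ((x.2 i) ^ 4 + (x.2 j) ^ 4 + (x.1 i) ^ 8 + (x.1 j) ^ 8)) (gibbsWeight ω₂ lam β γ N T) ∧
      ∫ x, ((x.2 i) ^ 2 + (x.2 j) ^ 2 + 72 * β ^ 2 * ((x.2 i) ^ 4 + (x.2 j) ^ 4 + (x.1 i) ^ 8 + (x.1 j) ^ 8))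
          ∂(gibbsWeight ω₂ lam β γ N T) ≤
        (2 * C₁ + 144 * β ^ 2 * (C₂ + C₄)) * ∫ x, Real.exp (-((pinnedChain ω₂ lam β γ).hamiltonian N x) / T) ∂volume := by
  have hP := localMomentQ_integrable_momentum_pow (N := N) hω hl hβ γ hT
  have hQ := localMoment_integrable_position_pow (N := N) hω hl hβ γ hT
  have hA : Integrable (fun x : PhaseSpace N => (x.2 i) ^ 2 + (x.2 j) ^ 2) (gibbsWeight ω₂ lam β γ N T) :=
    (hP i 2).add (hP j 2)
  have hB4 : Integrable (fun x : PhaseSpace N => (x.2 i) ^ 4 + (x.2 j) ^ 4) (gibbsWeight ω₂ lam β γ N T) :=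
    (hP i 4).add (hP j 4)
  have hB48 : Integrable (fun x : PhaseSpace N => (x.2 i) ^ 4 + (x.2 j) ^ 4 + (x.1 i) ^ 8) (gibbsWeight ω₂ lam β γ N T) :=
    hB4.add (hQ i 8)
  have hB : Integrable (fun x : PhaseSpace N => (x.2 i) ^ 4 + (x.2 j) ^ 4 + (x.1 i) ^ 8 + (x.1 j) ^ 8)
      (gibbsWeight ω₂ lam β γ N T) := hB48.add (hQ j 8)
  have hB' : Integrable (fun x : PhaseSpace N => 72 * β ^ 2 * ((x.2 i) ^ 4 + (x.2 j) ^ 4 + (x.1 i) ^ 8 + (x.1 j) ^ 8))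
      (gibbsWeight ω₂ lam β γ N T) := hB.const_mul _
  refine ⟨hA.add hB', ?_⟩
  rw [integral_add hA hB', integral_const_mul, integral_add (hP i 2) (hP j 2), integral_add hB48 (hQ j 8),
    integral_add hB4 (hQ i 8), integral_add (hP i 4) (hP j 4)]
  have h6 : 72 * β ^ 2 * ((∫ x, (x.2 i) ^ 4 ∂(gibbsWeight ω₂ lam β γ N T)) +
      (∫ x, (x.2 j) ^ 4 ∂(gibbsWeight ω₂ lam β γ N T)) + (∫ x, (x.1 i) ^ 8 ∂(gibbsWeight ω₂ lam β γ N T)) +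
      ∫ x, (x.1 j) ^ 8 ∂(gibbsWeight ω₂ lam β γ N T)) ≤
      72 * β ^ 2 * (C₂ * (∫ x, Real.exp (-((pinnedChain ω₂ lam β γ).hamiltonian N x) / T) ∂volume) +
        C₂ * (∫ x, Real.exp (-((pinnedChain ω₂ lam β γ).hamiltonian N x) / T) ∂volume) +
        C₄ * (∫ x, Real.exp (-((pinnedChain ω₂ lam β γ).hamiltonian N x) / T) ∂volume) +
        C₄ * ∫ x, Real.exp (-((pinnedChain ω₂ lam β γ).hamiltonian N x) / T) ∂volume) :=
    mul_le_mul_of_nonneg_left (add_le_add (add_le_add (add_le_add (hp4 i) (hp4 j)) (hq8 i)) (hq8 j)) (by positivity)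
  have h2i := hp2 i
  have h2j := hp2 j
  linarith

/-- **The core estimate at fixed `N`.** Given the single-site Gibbs moments `∫p_k² ≤ C₁Z`, `∫p_k⁴ ≤ C₂Z`,
`∫q_k⁸ ≤ C₄Z`: `∂_{q_b} J ∈ L²(μ_T)` and `∫ (∂_{q_b} J)² dμ_T ≤ 4(2C₁ + 144β²(C₂ + C₄)) Z`, at every site `b`
(`(∂_{q_b}J)² ≤ 2A²_{b-1,b} + 2A²_{b,b+1}`, each bond term dominated by a majorant `W` via `sq_bondPair_le`).
[folklore] -/
theorem localMomentQ_core {C₁ C₂ C₄ : ℝ}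
    (hp2 : ∀ k : Fin N, ∫ x, (x.2 k) ^ 2 ∂(gibbsWeight ω₂ lam β γ N T) ≤
      C₁ * ∫ x, Real.exp (-((pinnedChain ω₂ lam β γ).hamiltonian N x) / T) ∂volume)
    (hp4 : ∀ k : Fin N, ∫ x, (x.2 k) ^ 4 ∂(gibbsWeight ω₂ lam β γ N T) ≤
      C₂ * ∫ x, Real.exp (-((pinnedChain ω₂ lam β γ).hamiltonian N x) / T) ∂volume)
    (hq8 : ∀ k : Fin N, ∫ x, (x.1 k) ^ 8 ∂(gibbsWeight ω₂ lam β γ N T) ≤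
      C₄ * ∫ x, Real.exp (-((pinnedChain ω₂ lam β γ).hamiltonian N x) / T) ∂volume)
    (b : Fin N) :
    MemLp (partialQ b (fun z : PhaseSpace N => ∑ k : Fin N, (pinnedChain ω₂ lam β γ).bondCurrent N k z)) 2
        (gibbsWeight ω₂ lam β γ N T) ∧
      ∫ x, (partialQ b (fun z : PhaseSpace N => ∑ k : Fin N, (pinnedChain ω₂ lam β γ).bondCurrent N k z) x) ^ 2
          ∂(gibbsWeight ω₂ lam β γ N T) ≤
        4 * (2 * C₁ + 144 * β ^ 2 * (C₂ + C₄)) * ∫ x, Real.exp (-((pinnedChain ω₂ lam β γ).hamiltonian N x) / T) ∂volume := by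
  set P := pinnedChain ω₂ lam β γ with hP
  set μ := gibbsWeight ω₂ lam β γ N T with hμ
  set J : PhaseSpace N → ℝ := fun z => ∑ k : Fin N, P.bondCurrent N k z with hJ
  set W : Fin N → Fin N → PhaseSpace N → ℝ := fun i j x => (x.2 i) ^ 2 + (x.2 j) ^ 2 +
    72 * β ^ 2 * ((x.2 i) ^ 4 + (x.2 j) ^ 4 + (x.1 i) ^ 8 + (x.1 j) ^ 8) with hW
  have hW0 : ∀ i j x, 0 ≤ W i j x := fun i j x => by simp only [hW]; positivity
  -- `V'' = 1 + 3βr²`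
  have hV'' : ∀ r, deriv (deriv P.V) r = 1 + 3 * β * r ^ 2 := fun r => pinnedChain_deriv_deriv_V ω₂ lam β γ r
  have hVd : Differentiable ℝ (deriv P.V) := by
    rw [show deriv P.V = fun r => r + β * r ^ 3 from funext (pinnedChain_deriv_V ω₂ lam β γ)]
    fun_prop
  -- the two bond terms and their majorants
  have hd : ∀ x, partialQ b J x = _ := fun x => partialQ_sum_bondCurrent P hVd b x
  obtain ⟨j₁, hj₁⟩ : ∃ j : Fin N, ∀ x : PhaseSpace N, (if h : 0 < b.val then
      -((x.2 ⟨b.val - 1, by omega⟩ + x.2 b) / 2 * deriv (deriv P.V) (x.1 b - x.1 ⟨b.val - 1, by omega⟩))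
      else 0) ^ 2 ≤ W j b x := by
    by_cases h : 0 < b.val
    · refine ⟨⟨b.val - 1, by omega⟩, fun x => ?_⟩
      rw [dif_pos h, neg_sq, hV'']
      exact sq_bondPair_le β _ _ _ _
    · exact ⟨b, fun x => by rw [dif_neg h]; simpa using hW0 b b x⟩
  obtain ⟨j₂, hj₂⟩ : ∃ j : Fin N, ∀ x : PhaseSpace N, (if h : b.val + 1 < N then
      -((x.2 b + x.2 ⟨b.val + 1, h⟩) / 2 * deriv (deriv P.V) (x.1 ⟨b.val + 1, h⟩ - x.1 b)) else 0) ^ 2 ≤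
      W b j x := by
    by_cases h : b.val + 1 < N
    · refine ⟨⟨b.val + 1, h⟩, fun x => ?_⟩
      rw [dif_pos h, neg_sq, hV'']
      exact sq_bondPair_le β _ _ _ _
    · exact ⟨b, fun x => by rw [dif_neg h]; simpa using hW0 b b x⟩
  obtain ⟨hI₁, hle₁⟩ := localMomentQ_integral_majorant_le hω hl hβ γ hT hp2 hp4 hq8 j₁ b
  obtain ⟨hI₂, hle₂⟩ := localMomentQ_integral_majorant_le hω hl hβ γ hT hp2 hp4 hq8 b j₂
  -- pointwise domination
  have hptw : ∀ x : PhaseSpace N, (partialQ b J x) ^ 2 ≤ 2 * W j₁ b x + 2 * W b j₂ x := fun x => by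
    rw [hd x]
    have h1 := hj₁ x
    have h2 := hj₂ x
    nlinarith [sq_nonneg ((if h : 0 < b.val then
      -((x.2 ⟨b.val - 1, by omega⟩ + x.2 b) / 2 * deriv (deriv P.V) (x.1 b - x.1 ⟨b.val - 1, by omega⟩))
      else 0) + (if h : b.val + 1 < N then
      -((x.2 b + x.2 ⟨b.val + 1, h⟩) / 2 * deriv (deriv P.V) (x.1 ⟨b.val + 1, h⟩ - x.1 b)) else 0))]
  have hGint : Integrable (fun x : PhaseSpace N => 2 * W j₁ b x + 2 * W b j₂ x) μ :=
    (hI₁.const_mul 2).add (hI₂.const_mul 2)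
  have hJc : Continuous (partialQ b J) := continuous_partialQ (contDiff_totalBondCurrent ω₂ lam β γ N) (by simp) b
  have hJm : AEStronglyMeasurable (partialQ b J) μ := hJc.aestronglyMeasurable
  have hsqI : Integrable (fun x => (partialQ b J x) ^ 2) μ :=
    hGint.mono' (hJm.pow 2) (Eventually.of_forall fun x => by
      rw [Real.norm_eq_abs, abs_of_nonneg (sq_nonneg _)]
      exact hptw x)
  refine ⟨(memLp_two_iff_integrable_sq hJm).2 hsqI, ?_⟩
  calc ∫ x, (partialQ b J x) ^ 2 ∂μ ≤ ∫ x, (2 * W j₁ b x + 2 * W b j₂ x) ∂μ := integral_mono hsqI hGint hptw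
    _ = 2 * (∫ x, W j₁ b x ∂μ) + 2 * ∫ x, W b j₂ x ∂μ := by
        rw [integral_add (hI₁.const_mul 2) (hI₂.const_mul 2), integral_const_mul, integral_const_mul]
    _ ≤ 2 * ((2 * C₁ + 144 * β ^ 2 * (C₂ + C₄)) * ∫ x, Real.exp (-(P.hamiltonian N x) / T) ∂volume) +
          2 * ((2 * C₁ + 144 * β ^ 2 * (C₂ + C₄)) * ∫ x, Real.exp (-(P.hamiltonian N x) / T) ∂volume) := by
        gcongr
    _ = 4 * (2 * C₁ + 144 * β ^ 2 * (C₂ + C₄)) * ∫ x, Real.exp (-(P.hamiltonian N x) / T) ∂volume := by ring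

end Core

/-! ### The `N`-uniform local moment of `∂_{q_b} J` and the two-residual form of the reduction -/

/-- **Registered sub-goal `stub_localMomentQ`** (`N`-UNIFORM, local; hypothesis (Q) of `stub_mixedTapReduction`):
for the pinned chain (`ω₂ > 0`, `lam, β ≥ 0`) at `T > 0` there is `C = C(ω₂, lam, β, γ, T)` (here
`4(2C₁ + 144β²(C₂ + C₄))`, `C_m` the `N`-uniform `2m`-th single-coordinate Gibbs moment constants of
`SubBallisticWindow.GibbsMoments.stub_gibbsMoments` fed with `…GibbsPoincare.stub_gibbsPoincare`) with
`∂_{q_b} J ∈ L²(μ_T)` and `‖∂_{q_b} J‖²_{L²(μ_T)} ≤ C · Z` for every `N` and every contact `b`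
(`∂_{q_b} J = ½(p_b + p_{b+1})V''(r_b)[b+1<N] − ½(p_{b-1} + p_b)V''(r_{b-1})[0<b]`, `V'' = 1 + 3βr²`). [folklore] -/
theorem stub_localMomentQ : ∀ ω₂ lam β γ : ℝ, 0 < ω₂ → 0 ≤ lam → 0 ≤ β → ∀ T : ℝ, 0 < T →
    ∃ C : ℝ, ∀ (N : ℕ) (b : Fin N), (b.val = 0 ∨ b.val = N - 1) →
      MemLp (partialQ b (fun z : PhaseSpace N => ∑ k : Fin N, (pinnedChain ω₂ lam β γ).bondCurrent N k z)) 2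
        (gibbsWeight ω₂ lam β γ N T) ∧
      ∫ x, (partialQ b (fun z : PhaseSpace N => ∑ k : Fin N, (pinnedChain ω₂ lam β γ).bondCurrent N k z) x) ^ 2
          ∂(gibbsWeight ω₂ lam β γ N T) ≤
        C * ∫ x, Real.exp (-((pinnedChain ω₂ lam β γ).hamiltonian N x) / T) ∂volume := by
  intro ω₂ lam β γ hω hl hβ T hT
  have hPI := GibbsPoincare.stub_gibbsPoincare ω₂ lam β γ hω hl hβ T hT
  obtain ⟨C₁, hC₁⟩ := GibbsMoments.stub_gibbsMoments ω₂ lam β γ hω hl hβ T hT hPI 1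
  obtain ⟨C₂, hC₂⟩ := GibbsMoments.stub_gibbsMoments ω₂ lam β γ hω hl hβ T hT hPI 2
  obtain ⟨C₄, hC₄⟩ := GibbsMoments.stub_gibbsMoments ω₂ lam β γ hω hl hβ T hT hPI 4
  refine ⟨4 * (2 * C₁ + 144 * β ^ 2 * (C₂ + C₄)), fun N b _ => ?_⟩
  have hp2 : ∀ k : Fin N, ∫ x, (x.2 k) ^ 2 ∂(gibbsWeight ω₂ lam β γ N T) ≤
      C₁ * ∫ x, Real.exp (-((pinnedChain ω₂ lam β γ).hamiltonian N x) / T) ∂volume := fun k => by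
    have h := (hC₁ N k).2
    rw [show (2 * 1 : ℕ) = 2 from rfl] at h
    exact h
  have hp4 : ∀ k : Fin N, ∫ x, (x.2 k) ^ 4 ∂(gibbsWeight ω₂ lam β γ N T) ≤
      C₂ * ∫ x, Real.exp (-((pinnedChain ω₂ lam β γ).hamiltonian N x) / T) ∂volume := fun k => by
    have h := (hC₂ N k).2
    rw [show (2 * 2 : ℕ) = 4 from rfl] at h
    exact h
  have hq8 : ∀ k : Fin N, ∫ x, (x.1 k) ^ 8 ∂(gibbsWeight ω₂ lam β γ N T) ≤
      C₄ * ∫ x, Real.exp (-((pinnedChain ω₂ lam β γ).hamiltonian N x) / T) ∂volume := fun k => by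
    have h := (hC₄ N k).1
    rw [show (2 * 4 : ℕ) = 8 from rfl] at h
    exact h
  exact localMomentQ_core hω hl hβ γ hT hp2 hp4 hq8 b

/-- **`stub_mixedTap` from its two HONEST residuals** (`stub_mixedTapReduction` with (Q) discharged by
`stub_localMomentQ`): (M) the fixed-`N` membership `∂_{q_b}u ∈ L²(μ_T)` of the Kubo corrector and (D) the
`N`-uniform Hessian-drive budget `‖Σ_i (∂_{q_b}∂_{q_i}H) ∂_{p_i}u‖²_{L²(μ_T)} ≤ C(|⟨u,J⟩| + Z)` (R1 + R2 of card
drain-convexity-second-tap-identity) imply `MixedTapBound` verbatim. [folklore] -/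
theorem mixedTapBound_of_membership_of_hessianDrive
    (hQU : ∀ ω₂ lam β γ : ℝ, 0 < ω₂ → 0 < lam → 0 < β → 0 < γ → ∀ T : ℝ, 0 < T →
      ∀ (N : ℕ) (b : Fin N) (u : PhaseSpace N → ℝ), (b.val = 0 ∨ b.val = N - 1) →
        ContDiff ℝ 1 u → MemLp u 2 (gibbsWeight ω₂ lam β γ N T) →
        (∀ᵐ x ∂(gibbsWeight ω₂ lam β γ N T), Tendsto (fun τ : ℝ => ∫ t in Set.Ioc (0 : ℝ) τ,
            (∫ y, (∑ k : Fin N, (pinnedChain ω₂ lam β γ).bondCurrent N k y)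
              ∂((pinnedChain ω₂ lam β γ).transitionKernel N T T t.toNNReal x))) atTop (𝓝 (u x))) →
          MemLp (partialQ b u) 2 (gibbsWeight ω₂ lam β γ N T))
    (hGD : ∀ ω₂ lam β γ : ℝ, 0 < ω₂ → 0 < lam → 0 < β → 0 < γ → ∀ T : ℝ, 0 < T →
      ∃ C : ℝ, ∀ (N : ℕ) (b : Fin N) (u : PhaseSpace N → ℝ), (b.val = 0 ∨ b.val = N - 1) →
        ContDiff ℝ 1 u → MemLp u 2 (gibbsWeight ω₂ lam β γ N T) →
        (∀ᵐ x ∂(gibbsWeight ω₂ lam β γ N T), Tendsto (fun τ : ℝ => ∫ t in Set.Ioc (0 : ℝ) τ,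
            (∫ y, (∑ k : Fin N, (pinnedChain ω₂ lam β γ).bondCurrent N k y)
              ∂((pinnedChain ω₂ lam β γ).transitionKernel N T T t.toNNReal x))) atTop (𝓝 (u x))) →
          MemLp (fun x : PhaseSpace N => ∑ i : Fin N,
            partialQ b (partialQ i ((pinnedChain ω₂ lam β γ).hamiltonian N)) x * partialP i u x) 2
            (gibbsWeight ω₂ lam β γ N T) ∧
          ∫ x, (∑ i : Fin N, partialQ b (partialQ i ((pinnedChain ω₂ lam β γ).hamiltonian N)) x *
              partialP i u x) ^ 2 ∂(gibbsWeight ω₂ lam β γ N T) ≤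
            C * (|∫ x, u x * (∑ k : Fin N, (pinnedChain ω₂ lam β γ).bondCurrent N k x) ∂(gibbsWeight ω₂ lam β γ N T)| +
              ∫ x, Real.exp (-((pinnedChain ω₂ lam β γ).hamiltonian N x) / T) ∂volume)) :
    ∀ ω₂ lam β γ : ℝ, 0 < ω₂ → 0 < lam → 0 < β → 0 < γ → ∀ T : ℝ, 0 < T →
      ∃ C : ℝ, ∀ (N : ℕ) (b : Fin N) (u : PhaseSpace N → ℝ), (b.val = 0 ∨ b.val = N - 1) →
        ContDiff ℝ 1 u → MemLp u 2 (gibbsWeight ω₂ lam β γ N T) →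
        (∀ᵐ x ∂(gibbsWeight ω₂ lam β γ N T), Tendsto (fun τ : ℝ => ∫ t in Set.Ioc (0 : ℝ) τ,
            (∫ y, (∑ k : Fin N, (pinnedChain ω₂ lam β γ).bondCurrent N k y)
              ∂((pinnedChain ω₂ lam β γ).transitionKernel N T T t.toNNReal x))) atTop (𝓝 (u x))) →
          MemLp (partialQ b u) 2 (gibbsWeight ω₂ lam β γ N T) ∧
          T * ∫ x, partialQ b u x * partialP b u x ∂(gibbsWeight ω₂ lam β γ N T) ≤
            C * (|∫ x, u x * (∑ k : Fin N, (pinnedChain ω₂ lam β γ).bondCurrent N k x) ∂(gibbsWeight ω₂ lam β γ N T)| +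
              ∫ x, Real.exp (-((pinnedChain ω₂ lam β γ).hamiltonian N x) / T) ∂volume) :=
  stub_mixedTapReduction stub_localMomentQ hQU hGD

end Summit.AtomisticToContinuum.FouriersLaw.Theorems.OddSectorIrreversibility.TapLeak

end
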